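import Mathlib
import Literature.Analysis.ODE.SchrodingerODE
import Literature.Analysis.ODE.InverseSquareRecessiveVolterra
import HarnessLib

/-!
# The recessive solution `u ~ z^{-n}` of `u'' = (n(n+1)/z² + q) u` at `+∞`

Analysis/ODE support file (everything proved, no definitions). Let `P : ℝ → ℝ` be continuous with
`P z = n(n+1)/z² + q z` for `z ≥ A` (`A ≥ 1`), `q` continuous and SHORT RANGE: `s ↦ s|q s|`
integrable on `(A,∞)` with `∫_A^∞ s|q| ≤ ¼`. Then `u'' = P u` has a global classical solution
(`IsSchrodingerSol P U`) which is RECESSIVE at `+∞`: for `z > A`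

  `|zⁿ U(z) − 1| ≤ 4 ∫_z^∞ s|q|`,   `|zⁿ⁺¹ U'(z) + n zⁿ U(z)| ≤ 2 ∫_z^∞ s|q|`

(`exists_isSchrodingerSol_inverseSquare_recessive`). The Volterra fixed point `f = zⁿu` of
`InverseSquareRecessiveVolterra.lean` is differentiated through its two tail integrals
(`inverseSquare_volterra_hasDerivAt`: `f' = −z^{2n}J₁`, `u'' = Pu` by algebra) and globalised with
`SchrodingerODE.lean` (existence from `A+1`, uniqueness of the phase curve on `(A,∞)`). Classical
(Hartman, *ODE*, Ch. XI §9). Used for the true non-radiative solutions behind the far-side channel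
estimate of `FixedModeChannels` (route PhotonSphereChannels, stmt-FinalStateConjecture-10048).
-/

noncomputable section

namespace Literature.Analysis.ODE

open MeasureTheory Set Filter Topology intervalIntegral

variable {P q : ℝ → ℝ} {A : ℝ} {n : ℕ}

section
variable (hq : Continuous q) (hA : 1 ≤ A) (hqi : IntegrableOn (fun s => s * |q s|) (Ioi A))
include hq hA hqi

/-- **Differentiating the fixed point.** On `(A, ∞)` the function `u = f/zⁿ` built from the
Volterra fixed point satisfies `u' = −(n f + z^{2n+1}J₁)/z^{n+1}` and `u'' = P u`, where
`J₁ z = ∫_z^∞ s^{−2n} q f` and `P = n(n+1)/z² + q`. [folklore] -/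
theorem inverseSquare_volterra_hasDerivAt {f : ℝ → ℝ} (hf : Continuous f) (hfb : ∀ z, |f z| ≤ 2)
    (n : ℕ) (hfeq : ∀ z, f z = 1 - ((max z A) ^ (2 * n + 1)
          * (∫ s in Ioi (max z A), ((max s 1) ^ (2 * n))⁻¹ * q s * f s)
          - ∫ s in Ioi (max z A), s * q s * f s) / (2 * n + 1))
    (hPq : ∀ z, A ≤ z → P z = (n : ℝ) * (n + 1) / z ^ 2 + q z) {z : ℝ} (hz : A < z) :
    HasDerivAt (fun z => z * f z / z ^ (n + 1))
        (-(n * f z + z ^ (2 * n + 1) * ∫ s in Ioi z, ((max s 1) ^ (2 * n))⁻¹ * q s * f s)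
          / z ^ (n + 1)) z ∧
      HasDerivAt (fun z => -(n * f z + z ^ (2 * n + 1)
          * ∫ s in Ioi z, ((max s 1) ^ (2 * n))⁻¹ * q s * f s) / z ^ (n + 1))
        (P z * (z * f z / z ^ (n + 1))) z := by
  have hz0 : 0 < z := by linarith
  have hz1 : 1 ≤ z := by linarith
  have hN0 : (2 * (n : ℝ) + 1) ≠ 0 := by positivity
  set k₁ : ℝ → ℝ := fun s => ((max s 1) ^ (2 * n))⁻¹ * q s with hk₁
  set k₂ : ℝ → ℝ := fun s => s * q s with hk₂
  have hk₁c : Continuous k₁ := by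
    refine (Continuous.inv₀ ((continuous_id.max continuous_const).pow _) fun s => ?_).mul hq
    exact pow_ne_zero _ (by positivity)
  have hk₂c : Continuous k₂ := continuous_id.mul hq
  obtain ⟨hk₁fi, hk₂fi⟩ : IntegrableOn (fun s => k₁ s * f s) (Ioi A) ∧
      IntegrableOn (fun s => k₂ s * f s) (Ioi A) :=
    inverseSquare_weights_integrable hq hA hqi hf hfb le_rfl n
  set J₁ : ℝ → ℝ := fun b => ∫ s in Ioi b, k₁ s * f s with hJ₁
  set J₂ : ℝ → ℝ := fun b => ∫ s in Ioi b, k₂ s * f s with hJ₂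
  have hJ₁d : HasDerivAt J₁ (-(k₁ z * f z)) z :=
    hasDerivAt_setIntegral_Ioi_tail (hk₁c.mul hf) hk₁fi hz
  have hJ₂d : HasDerivAt J₂ (-(k₂ z * f z)) z :=
    hasDerivAt_setIntegral_Ioi_tail (hk₂c.mul hf) hk₂fi hz
  have hk₁z : k₁ z = (z ^ (2 * n))⁻¹ * q z := by simp only [hk₁, max_eq_left hz1]
  -- `f` agrees near `z` with the un-frozen formula
  set G : ℝ → ℝ := fun b => 1 - (b ^ (2 * n + 1) * J₁ b - J₂ b) / (2 * n + 1) with hG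
  have hfG : f =ᶠ[𝓝 z] G := by
    filter_upwards [Ioi_mem_nhds hz] with b hb
    have hb' : A ≤ b := le_of_lt hb
    rw [hfeq b]; simp only [hG, hJ₁, hJ₂, hk₁, hk₂, max_eq_left hb']
  have hGd : HasDerivAt G (-(z ^ (2 * n) * J₁ z)) z := by
    have h1 : HasDerivAt (fun b => b ^ (2 * n + 1) * J₁ b)
        (((2 * n + 1 : ℕ) : ℝ) * z ^ (2 * n + 1 - 1) * J₁ z + z ^ (2 * n + 1) * -(k₁ z * f z)) z :=
      (hasDerivAt_pow _ _).mul hJ₁d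
    have h := ((h1.sub hJ₂d).div_const (2 * n + 1)).const_sub 1
    refine h.congr_deriv ?_
    rw [hk₁z]; simp only [hk₂, Nat.add_sub_cancel]
    push_cast
    field_simp
    ring
  have hfd : HasDerivAt f (-(z ^ (2 * n) * J₁ z)) z := hGd.congr_of_eventuallyEq hfG
  -- `u = z f / z^{n+1}`
  have hpow_d : HasDerivAt (fun b : ℝ => b ^ (n + 1)) (((n + 1 : ℕ) : ℝ) * z ^ n) z := by
    simpa using hasDerivAt_pow (n + 1) z
  have hzn : z ^ (n + 1) ≠ 0 := pow_ne_zero _ hz0.ne'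
  have hu : HasDerivAt (fun b => b * f b / b ^ (n + 1))
      (-(n * f z + z ^ (2 * n + 1) * J₁ z) / z ^ (n + 1)) z := by
    have hnum : HasDerivAt (fun b => b * f b) (1 * f z + z * -(z ^ (2 * n) * J₁ z)) z :=
      (hasDerivAt_id z).mul hfd
    have h := hnum.div hpow_d hzn
    refine h.congr_deriv ?_
    push_cast
    field_simp
    ring
  refine ⟨hu, ?_⟩
  -- `u'' = P u`
  have hN : HasDerivAt (fun b => -(n * f b + b ^ (2 * n + 1) * J₁ b))
      (-(n * -(z ^ (2 * n) * J₁ z) + (((2 * n + 1 : ℕ) : ℝ) * z ^ (2 * n + 1 - 1) * J₁ z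
        + z ^ (2 * n + 1) * -(k₁ z * f z)))) z :=
    ((hfd.const_mul (n : ℝ)).add ((hasDerivAt_pow _ _).mul hJ₁d)).neg
  have h := hN.div hpow_d hzn
  refine h.congr_deriv ?_
  rw [hPq z hz.le, hk₁z]
  simp only [Nat.add_sub_cancel]
  push_cast
  field_simp
  ring

/-- **Recessive solution at `+∞` for an inverse-square potential with short-range perturbation.**
See the module docstring. [cite: Hartman2002, Ch. XI §9] -/
theorem exists_isSchrodingerSol_inverseSquare_recessive (hP : Continuous P)
    (hPq : ∀ z, A ≤ z → P z = (n : ℝ) * (n + 1) / z ^ 2 + q z)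
    (hQ : ∫ s in Ioi A, s * |q s| ≤ 1 / 4) :
    ∃ U : ℝ → ℝ, IsSchrodingerSol P U ∧
      (∀ z, A < z → |z ^ n * U z - 1| ≤ 4 * ∫ s in Ioi z, s * |q s|) ∧
      (∀ z, A < z → |z ^ (n + 1) * deriv U z + n * (z ^ n * U z)|
        ≤ 2 * ∫ s in Ioi z, s * |q s|) := by
  obtain ⟨f, hf, hfb, hfeq, hclose⟩ := exists_inverseSquare_volterra hq hA hqi hQ n
  set J₁ : ℝ → ℝ := fun b => ∫ s in Ioi b, ((max s 1) ^ (2 * n))⁻¹ * q s * f s with hJ₁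
  set u : ℝ → ℝ := fun z => z * f z / z ^ (n + 1) with hu
  set u' : ℝ → ℝ := fun z => -(n * f z + z ^ (2 * n + 1) * J₁ z) / z ^ (n + 1) with hu'
  have hder : ∀ z, A < z → HasDerivAt u (u' z) z ∧ HasDerivAt u' (P z * u z) z := fun z hz =>
    inverseSquare_volterra_hasDerivAt hq hA hqi hf hfb n hfeq hPq hz
  -- global solution through the data at `A + 1`
  obtain ⟨U, hU, hU0, hU1⟩ := exists_isSchrodingerSol hP (A + 1) (u (A + 1)) (u' (A + 1))
  have hEq : ∀ z, A < z → u z = U z ∧ u' z = deriv U z := by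
    intro z hz
    set b : ℝ := max z (A + 1) + 1 with hb
    have hzb : z < b := by simp only [hb]; linarith [le_max_left z (A + 1)]
    have hAb : A + 1 < b := by simp only [hb]; linarith [le_max_right z (A + 1)]
    obtain ⟨K, -, -, hK⟩ := exists_const_schrodingerField hP A b
    have key := ODE_solution_unique_of_mem_Ioo (v := schrodingerField P) (s := fun _ => univ)
      (K := K) (f := fun s => (u s, u' s)) (g := fun s => (U s, deriv U s))
      (a := A) (b := b) (t₀ := A + 1)
      (fun τ hτ => ((hK τ (Ioo_subset_Icc_self hτ)).1).lipschitzOnWith) ⟨by linarith, hAb⟩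
      (fun τ hτ => ⟨(hder τ hτ.1).1.prodMk (hder τ hτ.1).2, mem_univ _⟩)
      (fun τ _ => ⟨hU.hasDerivAt_phase τ, mem_univ _⟩) (by simp [hU0, hU1]) ⟨hz, hzb⟩
    exact ⟨congrArg Prod.fst key, congrArg Prod.snd key⟩
  refine ⟨U, hU, fun z hz => ?_, fun z hz => ?_⟩
  · have hz0 : z ≠ 0 := by linarith
    rw [← (hEq z hz).1]
    have : z ^ n * u z = f z := by simp only [hu]; field_simp; ring
    rw [this]
    have h := hclose z
    rwa [max_eq_left hz.le] at h
  · have hz0 : (z : ℝ) ≠ 0 := by linarith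
    rw [← (hEq z hz).1, ← (hEq z hz).2]
    have : z ^ (n + 1) * u' z + n * (z ^ n * u z) = -(z ^ (2 * n + 1) * J₁ z) := by
      simp only [hu, hu']; field_simp; ring
    rw [this, abs_neg]
    exact inverseSquare_tail_estimate₁ hq hA hqi hf hfb hz.le n

end

end Literature.Analysis.ODE
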